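import Summits.HodgeConjecture.HodgeConjecture.Theorems.F0P3cDyRamTableVanishingEasy      -- ★ (LH4-p03): №6 readings, `mk_eq_mk_out`, the easy zero entries (+ ★ №3∕№6, `F0P3cDyRamWMatrixConj`)
import Summits.HodgeConjecture.HodgeConjecture.Theorems.F0P3cDyRamProfilePiecesProps      -- ★ (B-p08 (g41)): `coe_mem_unitaryGroupOfForm_over` (`wMatrix u ∈ U(σ_w, Φ₃)` over the `StdForm` spelling)
import Literature.NumberTheory.Automorphic.UnitaryLatticeTreeApartment                     -- ★ `pairing_mulVec_mulVec_of_mem_unitary`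
import HarnessLib

/-!
# Crux `H413`, line LH4 «(D-RAM) FOUR-FRAME», tier 2 under `U4_Rows` §2: `NormClassPlus` IS A CLASS FUNCTION — `wMatrix x` is `Φ₃`-unitary, the `Φ₃`-pairing is
# `wMatrix`-invariant, `NormClassPlus σ_w ϖ d X` descends along conjugation; hence the LAST zero entry `(label 1, f_{T−})` of the unipotent table holds as soon as the
# shell-label lemma «on `K ∩` shell with `X² = 0`: `NormClassPlus X ⇒ LabelPlus … m* X`» does (taken here as an explicit hypothesis; next file)

Cell `hodgecm-mathlib` (D-0151), FLOOR 0, crux item H413 = `stmt-HodgeConjecture-24833`, route of record `HCCMUnconditional`; squad F0∕P3c∕LH4, Track A; dealer LH4-plan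
(g10) WORD #17∕#18 (U4 §2 `stub_U4_table_vanishing`, tree module `Cruxes/H413/Lines/F0_P3c_DyRamFourFrame_U4_Rows.lean`); tier-2 hand LH4-p03 (g11).  THEOREMS ONLY (no
`def`, no instance, no notation, no `sorry`, default heartbeats); lane `--supports stmt-HodgeConjecture-24833 --as helper`.

WHAT IS PROVED.  §1 `pairing_wMatrix_mulVec` over ★ `F0P3cDyRamProfilePiecesProps.coe_mem_unitaryGroupOfForm_over` (B-p08: `wMatrix x ∈ U(σ_w, Φ₃)` in the `StdForm`
spelling, via ★ `placeForm_antidiagThree_eq_over`)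
(`⟨W a, W b⟩ = ⟨a, b⟩`, ★ `pairing_mulVec_mulVec_of_mem_unitary`).  §2 `normClassPlus_conj` (`NormClassPlus σ_w ϖ d X ⇒ NormClassPlus σ_w ϖ d (wMatrix (x g x⁻¹) − 1)` for
`X = wMatrix g − 1`: test vector `y ↦ W y`), `normClassPlus_of_mk_eq` (class form).  §3 **`orbital_transvMinus_eq_zero_of_label_eq_one_of_shellLabel`**: GIVEN the shell-label
lemma as a hypothesis `hShell`, `unipotentLabel u = 1 ⇒ classOrbitalIntegral mU (pieceTransvMinus …) u = 0`; and **`table_vanishing_of_shellLabel`**: `hShell ⇒ ∀ u j,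
unipotentLabel u < j → classOrbitalIntegral mU ((gselStar j) …) u = 0` — the full conclusion of `stub_U4_table_vanishing` for ANY orbital-measure family, modulo `hShell`.

HONEST LABEL.  Count-neutral helper; the stub is NOT paid here (its payer = this ∘ the shell-label lemma, next file).  (D-RAM) verdict of record PRINT [LanglandsShelstad1989
Thm. p. 484 ∕ Rogawski1990 Prop. 4.9.1 (a)] ∕ XL; `HC_CM` is proved only modulo the 7 printed citations (2 remaining: hLiu418 = `stmt-HodgeConjecture-24832`, h413 =
`stmt-HodgeConjecture-24833`) until rung 0 closes.
-/

noncomputable section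

namespace Summit.HodgeConjecture.HodgeConjecture.Cruxes.H413.F0P3cDyRamNormClassPlusConj

open MeasureTheory Measure NumberField IsDedekindDomain Topology Filter
open Literature.NumberTheory.Automorphic Literature.NumberTheory.Automorphic.UnitaryGroup Literature.NumberTheory.Automorphic.IntegralReduction
open Literature.NumberTheory.Automorphic.UnitaryLatticeTree Literature.NumberTheory.Automorphic.HermitianLattice
open Literature.NumberTheory.Rogawski1990 Literature.NumberTheory.GaloisRepresentations
open Summit.HodgeConjecture.HodgeConjecture.Cruxes.H413.F0P3cDyRamFourFramePieces
open Summit.HodgeConjecture.HodgeConjecture.Cruxes.H413.F0P3cDyRamFourFrameUnipotentLabelDefs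
open Summit.HodgeConjecture.HodgeConjecture.Cruxes.H413.F0P3cDyRamPiecesShellLemmas
open Summit.HodgeConjecture.HodgeConjecture.Cruxes.H413.F0P3cDyRamWMatrixConj
open Summit.HodgeConjecture.HodgeConjecture.Cruxes.H413.F0P3cDyRamTableVanishingEasy
open Summit.HodgeConjecture.HodgeConjecture.Cruxes.H413 (F0P3cDyRamProfilePiecesProps.coe_mem_unitaryGroupOfForm_over)
open scoped Matrix MatrixGroups Classical ValuativeRel

variable (L : Type) [Field L] [NumberField L] [IsCMField L] {v : HeightOneSpectrum (𝓞 ↥(maximalRealSubfield L))}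
  (w : UnitaryGroup.PlacesOver L v) (hw : IsCMField.complexConj L • w.1 = w.1)

/-! ## §1  `wMatrix x` is `Φ₃`-unitary; the pairing is invariant -/

/-- **The `Φ₃`-pairing is `wMatrix`-invariant**: `⟨W a, W b⟩ = ⟨a, b⟩` for `W = wMatrix x`. -/
theorem pairing_wMatrix_mulVec (x : ((UnitaryGroup.cmDatum L 3 (Matrix.of fun i j : Fin 3 => if i.val + j.val + 1 = 3 then (1 : L) else 0)).Local v)) (a b : Fin 3 → w.1.adicCompletion L) :
    pairing (galAdicCompletionMap (L := L) (IsCMField.complexConj L) hw) ((StdForm.antidiagonal 3).over (w.1.adicCompletion L)) ((wMatrix L w hw x).mulVec a) ((wMatrix L w hw x).mulVec b) =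
      pairing (galAdicCompletionMap (L := L) (IsCMField.complexConj L) hw) ((StdForm.antidiagonal 3).over (w.1.adicCompletion L)) a b :=
  pairing_mulVec_mulVec_of_mem_unitary (F0P3cDyRamProfilePiecesProps.coe_mem_unitaryGroupOfForm_over L w hw x) a b

/-! ## §2  `NormClassPlus` descends along conjugation -/

/-- **`NormClassPlus` is conjugation-invariant**: for `X := wMatrix g − 1` and the conjugate `x g x⁻¹`, `NormClassPlus σ_w ϖ d X ⇒ NormClassPlus σ_w ϖ d (wMatrix (x g x⁻¹) − 1)`
(test vector `y ↦ W y`, `W = wMatrix x`; `⟨W y, W X W⁻¹ W y⟩ = ⟨y, X y⟩`). -/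
theorem normClassPlus_conj (ϖ : w.1.adicCompletion L) (d : ℕ)
    {x g : ((UnitaryGroup.cmDatum L 3 (Matrix.of fun i j : Fin 3 => if i.val + j.val + 1 = 3 then (1 : L) else 0)).Local v)}
    (h : NormClassPlus (galAdicCompletionMap (L := L) (IsCMField.complexConj L) hw) ϖ d (wMatrix L w hw g - 1)) :
    NormClassPlus (galAdicCompletionMap (L := L) (IsCMField.complexConj L) hw) ϖ d (wMatrix L w hw (x * g * x⁻¹) - 1) := by
  obtain ⟨y, y', z, hne, heq⟩ := h
  have key : pairing (galAdicCompletionMap (L := L) (IsCMField.complexConj L) hw) ((StdForm.antidiagonal 3).over (w.1.adicCompletion L))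
      ((wMatrix L w hw x).mulVec y) ((wMatrix L w hw (x * g * x⁻¹) - 1).mulVec ((wMatrix L w hw x).mulVec y)) =
      pairing (galAdicCompletionMap (L := L) (IsCMField.complexConj L) hw) ((StdForm.antidiagonal 3).over (w.1.adicCompletion L)) y ((wMatrix L w hw g - 1).mulVec y) := by
    rw [wMatrix_conj_sub_one, Matrix.mulVec_mulVec, Matrix.mul_assoc, (wMatrix_mul_wMatrix_inv L w hw x).2, Matrix.mul_one, ← Matrix.mulVec_mulVec,
      pairing_wMatrix_mulVec]
  exact ⟨(wMatrix L w hw x).mulVec y, y', z, by rw [key]; exact hne, by rw [key]; exact heq⟩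

/-- **Class form**: `ConjClasses.mk g′ = ConjClasses.mk g`, `NormClassPlus … (wMatrix g − 1) ⇒ NormClassPlus … (wMatrix g′ − 1)`. -/
theorem normClassPlus_of_mk_eq (ϖ : w.1.adicCompletion L) (d : ℕ)
    {g g' : ((UnitaryGroup.cmDatum L 3 (Matrix.of fun i j : Fin 3 => if i.val + j.val + 1 = 3 then (1 : L) else 0)).Local v)} (hc : ConjClasses.mk g' = ConjClasses.mk g)
    (h : NormClassPlus (galAdicCompletionMap (L := L) (IsCMField.complexConj L) hw) ϖ d (wMatrix L w hw g - 1)) :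
    NormClassPlus (galAdicCompletionMap (L := L) (IsCMField.complexConj L) hw) ϖ d (wMatrix L w hw g' - 1) := by
  obtain ⟨x, hx⟩ := isConj_iff.1 (ConjClasses.mk_eq_mk_iff_isConj.1 hc.symm)
  rw [← hx]
  exact normClassPlus_conj L w hw ϖ d h

/-! ## §3  The last zero entry, modulo the shell-label lemma -/

/-- `unipotentLabel u = 1 ⇒` the representative has `X ≠ 0`, `X² = 0` and `NormClassPlus` (read ★ №6 back). -/
theorem normClassPlus_of_label_eq_one (ϖ : w.1.adicCompletion L)
    (u : ConjClasses ((UnitaryGroup.cmDatum L 3 (Matrix.of fun i j : Fin 3 => if i.val + j.val + 1 = 3 then (1 : L) else 0)).Local v)) (h1 : unipotentLabel L w hw ϖ u = 1) :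
    NormClassPlus (galAdicCompletionMap (L := L) (IsCMField.complexConj L) hw) ϖ (dOfPlace L v w) (wMatrix L w hw (Quotient.out u) - 1) := by
  unfold unipotentLabel at h1
  split_ifs at h1 with h0 hsq hN
  · exact absurd h1 (by decide)
  · exact hN
  · exact absurd h1 (by decide)
  · exact absurd h1 (by decide)

/-- **THE LAST ZERO ENTRY `(label 1, f_{T−})`, MODULO THE SHELL-LABEL LEMMA.**  If, at this place, every `g ∈ K` whose `X := wMatrix g − 1` is on the near-transvection
shell with `X² = 0` and `NormClassPlus` carries the label `LabelPlus … m* X` (`hShell` — the value-set lemma, next file), then `unipotentLabel u = 1 ⇒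
classOrbitalIntegral mU (pieceTransvMinus …) u = 0` (every class member inherits `X² = 0` and `NormClassPlus`; on `K ∩` shell it then has the label `+`, so it is
outside `f_{T−}`'s support). -/
theorem orbital_transvMinus_eq_zero_of_label_eq_one_of_shellLabel (ϖ : w.1.adicCompletion L)
    [MeasurableSpace ((UnitaryGroup.cmDatum L 3 (Matrix.of fun i j : Fin 3 => if i.val + j.val + 1 = 3 then (1 : L) else 0)).Local v)]
    [∀ γ : ((UnitaryGroup.cmDatum L 3 (Matrix.of fun i j : Fin 3 => if i.val + j.val + 1 = 3 then (1 : L) else 0)).Local v), MeasurableSpace (((UnitaryGroup.cmDatum L 3 (Matrix.of fun i j : Fin 3 => if i.val + j.val + 1 = 3 then (1 : L) else 0)).Local v) ⧸ Subgroup.centralizer ({γ} : Set ((UnitaryGroup.cmDatum L 3 (Matrix.of fun i j : Fin 3 => if i.val + j.val + 1 = 3 then (1 : L) else 0)).Local v)))]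
    (mU : OrbitalMeasureFamily ((UnitaryGroup.cmDatum L 3 (Matrix.of fun i j : Fin 3 => if i.val + j.val + 1 = 3 then (1 : L) else 0)).Local v))
    (hShell : ∀ g : ((UnitaryGroup.cmDatum L 3 (Matrix.of fun i j : Fin 3 => if i.val + j.val + 1 = 3 then (1 : L) else 0)).Local v),
      g ∈ cmLocalIntegralLevel L 3 (Matrix.of fun i j : Fin 3 => if i.val + j.val + 1 = 3 then (1 : L) else 0) v →
      NearTransvShell ϖ (dOfPlace L v w % 2) (mstarFn L v w) (wMatrix L w hw g - 1) →
      (wMatrix L w hw g - 1) * (wMatrix L w hw g - 1) = 0 →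
      NormClassPlus (galAdicCompletionMap (L := L) (IsCMField.complexConj L) hw) ϖ (dOfPlace L v w) (wMatrix L w hw g - 1) →
      LabelPlus (galAdicCompletionMap (L := L) (IsCMField.complexConj L) hw) ϖ (dOfPlace L v w) (mstarFn L v w) (wMatrix L w hw g - 1))
    (u : ConjClasses ((UnitaryGroup.cmDatum L 3 (Matrix.of fun i j : Fin 3 => if i.val + j.val + 1 = 3 then (1 : L) else 0)).Local v)) (h1 : unipotentLabel L w hw ϖ u = 1) :
    classOrbitalIntegral mU (pieceTransvMinus L v w hw ϖ) u = 0 := by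
  have hN := normClassPlus_of_label_eq_one L w hw ϖ u h1
  have hsq := sq_eq_zero_of_label_ne_three L w hw ϖ u (by rw [h1]; decide)
  unfold pieceTransvMinus
  refine classOrbitalIntegral_indicator_eq_zero_of_forall_not_mem mU _ u fun g hg hmem => ?_
  rw [Set.mem_setOf_eq] at hmem
  obtain ⟨hK, hsh, hlab⟩ := hmem
  exact hlab (hShell g hK hsh (wMatrix_sub_one_sq_eq_zero_of_mk_eq L w hw (mk_eq_mk_out hg) hsq) (normClassPlus_of_mk_eq L w hw ϖ _ (mk_eq_mk_out hg) hN))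

/-- **`stub_U4_table_vanishing`'S CONCLUSION, MODULO THE SHELL-LABEL LEMMA**: `hShell ⇒ ∀ u j, unipotentLabel u < j → classOrbitalIntegral mU ((gselStar j) …) u = 0`
(★ `table_vanishing_easy` for every entry but `(label 1, j = 2)`, §3 for that one). -/
theorem table_vanishing_of_shellLabel (ϖ : w.1.adicCompletion L)
    [MeasurableSpace ((UnitaryGroup.cmDatum L 3 (Matrix.of fun i j : Fin 3 => if i.val + j.val + 1 = 3 then (1 : L) else 0)).Local v)]
    [∀ γ : ((UnitaryGroup.cmDatum L 3 (Matrix.of fun i j : Fin 3 => if i.val + j.val + 1 = 3 then (1 : L) else 0)).Local v), MeasurableSpace (((UnitaryGroup.cmDatum L 3 (Matrix.of fun i j : Fin 3 => if i.val + j.val + 1 = 3 then (1 : L) else 0)).Local v) ⧸ Subgroup.centralizer ({γ} : Set ((UnitaryGroup.cmDatum L 3 (Matrix.of fun i j : Fin 3 => if i.val + j.val + 1 = 3 then (1 : L) else 0)).Local v)))]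
    (mU : OrbitalMeasureFamily ((UnitaryGroup.cmDatum L 3 (Matrix.of fun i j : Fin 3 => if i.val + j.val + 1 = 3 then (1 : L) else 0)).Local v))
    (hShell : ∀ g : ((UnitaryGroup.cmDatum L 3 (Matrix.of fun i j : Fin 3 => if i.val + j.val + 1 = 3 then (1 : L) else 0)).Local v),
      g ∈ cmLocalIntegralLevel L 3 (Matrix.of fun i j : Fin 3 => if i.val + j.val + 1 = 3 then (1 : L) else 0) v →
      NearTransvShell ϖ (dOfPlace L v w % 2) (mstarFn L v w) (wMatrix L w hw g - 1) →
      (wMatrix L w hw g - 1) * (wMatrix L w hw g - 1) = 0 →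
      NormClassPlus (galAdicCompletionMap (L := L) (IsCMField.complexConj L) hw) ϖ (dOfPlace L v w) (wMatrix L w hw g - 1) →
      LabelPlus (galAdicCompletionMap (L := L) (IsCMField.complexConj L) hw) ϖ (dOfPlace L v w) (mstarFn L v w) (wMatrix L w hw g - 1))
    (u : ConjClasses ((UnitaryGroup.cmDatum L 3 (Matrix.of fun i j : Fin 3 => if i.val + j.val + 1 = 3 then (1 : L) else 0)).Local v)) (j : Fin 4)
    (hlt : unipotentLabel L w hw ϖ u < j) : classOrbitalIntegral mU ((gselStar j) L v w hw ϖ) u = 0 := by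
  by_cases hj : j ≠ 2 ∨ unipotentLabel L w hw ϖ u = 0
  · exact table_vanishing_easy L w hw ϖ mU u j hlt hj
  · simp only [not_or, ne_eq, not_not] at hj
    obtain ⟨rfl, hne0⟩ := hj
    have hlt' : (unipotentLabel L w hw ϖ u).val < 2 := Fin.lt_def.1 hlt
    have h1 : unipotentLabel L w hw ϖ u = 1 := by
      refine Fin.ext ?_
      have hne0' : (unipotentLabel L w hw ϖ u).val ≠ 0 := fun h => hne0 (Fin.ext h)
      change _ = 1
      omega
    exact orbital_transvMinus_eq_zero_of_label_eq_one_of_shellLabel L w hw ϖ mU hShell u h1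

end Summit.HodgeConjecture.HodgeConjecture.Cruxes.H413.F0P3cDyRamNormClassPlusConj

end
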